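import Mathlib
import HarnessLib
import Literature.MathematicalPhysics.QuantumLattice.GaugeGroups
import Summits.Ventures.LatticeQCDFlow.Exactness.SchwingerDysonResidual

/-!
# `⟨R_l⟩ = 0` on the lattice: the one-link identity survives averaging over the other links

HONEST FRAMING: exact (Metropolis-corrected) sampling algorithms for lattice gauge theory;
figures of merit are autocorrelation/cost numbers at stated couplings and volumes; no
continuum-physics claim.

Venture `LatticeQCDFlow` (cell pub-lqcd), topic `Exactness`, FANOUT row 9 (eng-latcore).  NEW
WORK of the cell over Mathlib (Fubini, `MeasureTheory.integral_prod_symm`); nothing is cited as a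
fact.

`SchwingerDysonResidual.lean` proves the ONE-LINK statement: for a fixed staple matrix `R`,
`∫ sdResidual β N (U R) e^{(β/N) Re tr (U R)} dHaar_SU(N)(U) = 0`.  On the lattice the staple sum
`R_l` of link `l` is a function of the OTHER links, and the Gibbs factor splits as
`e^{−S(U)} = e^{(β/N) Re tr (U_l R_l(U_{≠l}))} · w(U_{≠l})` with `w` free of `U_l` (Wilson action,
any plaquette weights: open BC, defects, PTBC `c(r)`).  Writing the configuration space as
`SU(N) × Ω` (`Ω` = the other links with their product Haar measure, or ANY s-finite measure space),
Fubini gives the lattice statement: the residual of link `l` has mean zero under the full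
(un-normalised) Gibbs measure — `schwingerDyson_residual_prod`.  The identification
`(links → SU(N)) ≃ SU(N) × (other links → SU(N))` is `MeasurableEquiv.piFinSuccAbove` /
`measurePreserving_piFinSuccAbove` of Mathlib and is not repeated here.

## Content

* `schwingerDyson_residual_prod` — `(Ω, ν)` s-finite, `R : Ω → Matrix`, `w : Ω → ℂ`; if the joint
  integrand is integrable then
  `∫ sdResidual β N (U · R ω) e^{(β/N) Re tr (U R ω)} w(ω) d(μ_SU ⊗ ν)(U, ω) = 0`.
* `schwingerDyson_residual_prod_of_continuous` — the hypothesis-free form for a compact `Ω` with a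
  finite measure and continuous `R`, `w` (the lattice case: `Ω` a finite product of copies of
  `SU(N)`, `R` = staple sum, `w` = the remaining Boltzmann factor — all continuous).

Not here: normalisation by the partition function (divides a zero), the sum over links (a finite sum
of zeros), statistical power.
-/

namespace Summit.Ventures.LatticeQCDFlow.Exactness

open Matrix MeasureTheory Complex

variable {n : Type*} [Fintype n] [DecidableEq n]

/-- **Lattice form of `⟨R_l⟩ = 0` (Fubini over the other links).**  For the Haar probability `μ` of
`SU(N)`, any s-finite measure space `(Ω, ν)` ("the other links"), any measurable staple function
`R : Ω → Matrix` and weight `w : Ω → ℂ` ("the rest of the Boltzmann factor"): if the joint integrand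
is integrable, `∫ sdResidual β N (U R(ω)) · e^{(β/N) Re tr (U R(ω))} · w(ω) d(μ ⊗ ν) = 0`. -/
theorem schwingerDyson_residual_prod [Nonempty n] {Ω : Type*} [MeasurableSpace Ω]
    (ν : Measure Ω) [SFinite ν] (β : ℝ) (R : Ω → Matrix n n ℂ) (w : Ω → ℂ)
    (hint : Integrable (fun p : Matrix.specialUnitaryGroup n ℂ × Ω =>
        sdResidual β (Fintype.card n) ((p.1 : Matrix n n ℂ) * R p.2)
          * ((Real.exp (β / Fintype.card n * (((p.1 : Matrix n n ℂ) * R p.2).trace).re) : ℝ) : ℂ)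
          * w p.2)
      ((Literature.MathematicalPhysics.QuantumFieldTheory.haarProbability
          (Matrix.specialUnitaryGroup n ℂ)).prod ν)) :
    ∫ p, sdResidual β (Fintype.card n) ((p.1 : Matrix n n ℂ) * R p.2)
          * ((Real.exp (β / Fintype.card n * (((p.1 : Matrix n n ℂ) * R p.2).trace).re) : ℝ) : ℂ)
          * w p.2
      ∂((Literature.MathematicalPhysics.QuantumFieldTheory.haarProbability
          (Matrix.specialUnitaryGroup n ℂ)).prod ν) = 0 := by
  rw [integral_prod_symm _ hint]
  refine (integral_congr_ae (Filter.Eventually.of_forall fun ω => ?_)).trans (integral_zero _ _)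
  change ∫ U, sdResidual β (Fintype.card n) ((U : Matrix n n ℂ) * R ω)
      * ((Real.exp (β / Fintype.card n * (((U : Matrix n n ℂ) * R ω).trace).re) : ℝ) : ℂ) * w ω
    ∂(Literature.MathematicalPhysics.QuantumFieldTheory.haarProbability
        (Matrix.specialUnitaryGroup n ℂ)) = 0
  rw [integral_mul_const, schwingerDyson_residual β (R ω), zero_mul]

/-- **Hypothesis-free lattice form for continuous data on a compact second-countable `Ω`** (the
lattice case: `Ω = (other links → SU(N))`, `R` the staple sum, `w` the remaining Boltzmann factor). -/
theorem schwingerDyson_residual_prod_of_continuous [Nonempty n] {Ω : Type*} [TopologicalSpace Ω]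
    [CompactSpace Ω] [SecondCountableTopology Ω] [MeasurableSpace Ω] [BorelSpace Ω]
    (ν : Measure Ω) [IsFiniteMeasure ν]
    (β : ℝ) {R : Ω → Matrix n n ℂ} {w : Ω → ℂ} (hR : Continuous R) (hw : Continuous w) :
    ∫ p, sdResidual β (Fintype.card n) ((p.1 : Matrix n n ℂ) * R p.2)
          * ((Real.exp (β / Fintype.card n * (((p.1 : Matrix n n ℂ) * R p.2).trace).re) : ℝ) : ℂ)
          * w p.2
      ∂((Literature.MathematicalPhysics.QuantumFieldTheory.haarProbability
          (Matrix.specialUnitaryGroup n ℂ)).prod ν) = 0 := by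
  refine schwingerDyson_residual_prod ν β R w
    (Continuous.integrable_of_hasCompactSupport ?_ (HasCompactSupport.of_compactSpace _))
  have hA : Continuous fun p : Matrix.specialUnitaryGroup n ℂ × Ω => (p.1 : Matrix n n ℂ) * R p.2 :=
    (continuous_subtype_val.comp continuous_fst).matrix_mul (hR.comp continuous_snd)
  have htr : Continuous fun p : Matrix.specialUnitaryGroup n ℂ × Ω =>
      ((p.1 : Matrix n n ℂ) * R p.2).trace := hA.matrix_trace
  refine Continuous.mul (Continuous.mul ?_ (continuous_ofReal.comp (Real.continuous_exp.comp
    (continuous_const.mul (continuous_re.comp htr))))) (hw.comp continuous_snd)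
  unfold sdResidual
  refine Continuous.add (continuous_const.mul htr) (continuous_const.mul
    (Continuous.sub (Continuous.sub (hA.mul hA).matrix_trace (hA.matrix_conjTranspose.mul hA).matrix_trace)
      ((continuous_const.mul (continuous_ofReal.comp (continuous_im.comp htr))).mul htr)))

end Summit.Ventures.LatticeQCDFlow.Exactness
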